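import Summits.KontsevichZagierPeriods.KontsevichZagierPeriods.Theses.AyoubSpecialisation
import Summits.KontsevichZagierPeriods.KontsevichZagierPeriods.Theorems.TerasomaMultiplicationBetaCancellationOfAyoubPiCancellation
import Summits.KontsevichZagierPeriods.KontsevichZagierPeriods.Theorems.TerasomaMultiplicationBetaCancellationStubSlabDescent
import Summits.KontsevichZagierPeriods.KontsevichZagierPeriods.Theorems.TerasomaMultiplicationBetaCancellationStubTriangleConst
import Summits.KontsevichZagierPeriods.KontsevichZagierPeriods.Theorems.TerasomaMultiplicationBetaCancellationStubArchimedesTriangle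
import Summits.KontsevichZagierPeriods.KontsevichZagierPeriods.Theorems.TerasomaMultiplicationBetaCancellationStubPiMulFibred
import Summits.KontsevichZagierPeriods.KontsevichZagierPeriods.Theorems.TerasomaMultiplicationBetaCancellationStubWallRestrict
import Summits.KontsevichZagierPeriods.KontsevichZagierPeriods.Theorems.TerasomaMultiplicationBetaCancellationStubWallLift
import Summits.KontsevichZagierPeriods.KontsevichZagierPeriods.Theorems.TerasomaMultiplicationBetaCancellationStubFibredLeWall

/-!
# `π`-cancellation for WALL-RESPECTING certificates, and the crux as "wall reduction"

Assembly file of the crux lead (seat c8, `--supports` stmt-KontsevichZagierPeriods-13633, line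
`dirichlet-companion-to-pi`). Item 0540 (`AyoubPiCancellation`: for the pinned disc family
`P n r = [unit disc in coordinates 0,1] × r`, `lift (of ∘ P) c ∈ relations → c ∈ relations`) is
PROVED here for every certificate lying in the closure of the **wall-respecting generators** at the
chord `x = -1/2` of the first disc coordinate: all additivity moves, the changes of variables `Φ` of
`(n+1)`-dimensional representations that preserve the two open sides of the wall pointwise,
`(Φ x 0 < -1/2 ↔ x 0 < -1/2) ∧ (-1/2 < Φ x 0 ↔ -1/2 < x 0)` on the domain (however they move `x 0`),
and the Newton–Leibniz moves over a base of dimension `≥ 1` (`KZ.fibredNewtonLeibnizRel`). The set is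
written inline (no definition). It strictly contains `KZ.fibredGenerators` (`stub_fibredLeWall`,
p118930), so this extends seat c7's fibred `π`-cancellation (`fibred_ayoubPiCancellation`, p115210):

  `wall_ayoubPiCancellation : lift (of ∘ P) c ∈ closure (wall generators) → c ∈ relations`.

Proof. Restriction to an open side `S ∈ {(-∞,-1/2), (-1/2,∞)}` of the wall is an additive
`H_S : FormalRep →+ FormalRep` (`exists_sideRestrict`: `FreeAbelianGroup.lift` of `IntegralRep.restrict`,
constants to `0`); it maps the wall closure into `relations` generator by generator
(`stub_wallRestrict`, p119124), and on the disc family it computes the slab pieces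
`[[π]|{-2<x<-1/2}] * c`, `[[π]|{-1/2<x<2}] * c` (`stub_wallLift`, p119520, since `x² + y² ≤ 1` pins
`-1 ≤ x ≤ 1`). Archimedes' trisection (`stub_archimedesOfTriangle`, `stub_triangleConst`) finishes:
`[T]·c ∈ relations` for the inscribed triangle `T ∼ 3√3/4`, hence `c ∈ relations`.

Consequently the crux `BetaCancellation` (≡ item 0540) is EQUIVALENT to WALL REDUCTION — "every
relation among disc multiples is a wall-respecting relation" (`betaCancellation_iff_wallReduction`);
the only move a counterexample to 0540 can use essentially is a rule-(2) substitution carrying mass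
across the chord `x = -1/2`. This is the maximal generatorwise form of restriction descent: for the
subgroup `{x ∈ relations | H_L x ∈ relations}` itself the statement is one-segment descent
(`piCancellation_iff_segmentDescent`, p115210).
-/

noncomputable section

-- `Summit.KontsevichZagierPeriods.KontsevichZagierPeriods.…` is the tree's mandated layout (single-conjunct summit).
set_option linter.dupNamespace false

namespace Summit.KontsevichZagierPeriods.KontsevichZagierPeriods.BetaCancellationLine

open Set
open Literature.NumberTheory.Transcendental
open Literature.NumberTheory.Transcendental.KZ

/-- **Side restrictions exist**: for a side set `S` with `{z | z 0 ∈ S}` semialgebraic in every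
dimension `≥ 1` there is an additive `H : FormalRep →+ FormalRep` killing constants and restricting
every representation of dimension `≥ 1` to `{z 0 ∈ S}` (`FreeAbelianGroup.lift` of
`IntegralRep.restrict`; the value on `[r]` is pinned by domain and integrand, `KZ.IntegralRep.ext'`).
[folklore] -/
theorem exists_sideRestrict (S : Set ℝ)
    (hS : ∀ k : ℕ, Literature.ModelTheory.ExponentialFields.IsSemialgebraic ℚ
      {z : Fin (k + 1) → ℝ | z 0 ∈ S}) :
    ∃ H : FormalRep →+ FormalRep,
      (∀ r : IntegralRep 0, H (of r) = 0) ∧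
      (∀ (k : ℕ) (r s : IntegralRep (k + 1)), s.domain = r.domain ∩ {z | z 0 ∈ S} →
          s.integrand = r.integrand → H (of r) = of s) := by
  classical
  refine ⟨FreeAbelianGroup.lift (fun s : (Σ n, IntegralRep n) => match s with
      | ⟨0, _⟩ => 0
      | ⟨k + 1, r⟩ => of (r.restrict (r.domain ∩ {z | z 0 ∈ S})
          (r.isSemialgebraic_domain.inter (hS k)) inter_subset_left)), ?_, ?_⟩
  · intro r
    show FreeAbelianGroup.lift _ (FreeAbelianGroup.of _) = 0
    rw [FreeAbelianGroup.lift_apply_of]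
  · intro k r s hd hi
    show FreeAbelianGroup.lift _ (FreeAbelianGroup.of _) = of s
    rw [FreeAbelianGroup.lift_apply_of]
    exact congrArg of (IntegralRep.ext' (by rw [IntegralRep.domain_restrict, hd])
      (by rw [IntegralRep.integrand_restrict, hi]))

/-- **`π`-CANCELLATION FOR WALL-RESPECTING CERTIFICATES** (item 0540 restricted to the closure of the
wall-respecting generators at `x = -1/2`, unconditional): for every pinned disc family `P` and every
formal combination `c`, if `lift (of ∘ P) c` lies in that closure then `c` is a relation — restrict to
the two open sides of the wall (`stub_wallRestrict`, `stub_wallLift`), then Archimedes' trisection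
(`stub_archimedesOfTriangle`, `stub_triangleConst`). [folklore] -/
theorem wall_ayoubPiCancellation :
    ∀ (P : ∀ n : ℕ, IntegralRep n → IntegralRep (n + 2)),
      (∀ (n : ℕ) (r : IntegralRep n), (P n r).domain = {z : Fin (n + 2) → ℝ | z 0 ^ 2 + z 1 ^ 2 ≤ 1 ∧ (fun i : Fin n => z i.succ.succ) ∈ r.domain} ∧ (P n r).integrand = fun z => r.integrand (fun i : Fin n => z i.succ.succ)) →
      ∀ c : FormalRep,
        FreeAbelianGroup.lift (fun s : (Σ n, IntegralRep n) => of (P s.1 s.2)) c ∈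
          AddSubgroup.closure (domainAddRel ∪ integrandAddRel ∪
          {x | ∃ (n : ℕ) (r r' : IntegralRep (n + 1)) (Φ : (Fin (n + 1) → ℝ) → (Fin (n + 1) → ℝ))
              (Φ' : (Fin (n + 1) → ℝ) → (Fin (n + 1) → ℝ) →L[ℝ] (Fin (n + 1) → ℝ)),
            IsSemialgebraicMapOn ℚ r.domain Φ ∧
            (∀ x ∈ r.domain, HasFDerivWithinAt Φ (Φ' x) r.domain x) ∧ Set.InjOn Φ r.domain ∧
            r'.domain = Φ '' r.domain ∧
            (∀ x ∈ r.domain, r.integrand x = r'.integrand (Φ x) * |(Φ' x).det|) ∧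
            (∀ x ∈ r.domain, (Φ x 0 < -1/2 ↔ x 0 < -1/2) ∧ (-1/2 < Φ x 0 ↔ -1/2 < x 0)) ∧
            x = of r - of r'} ∪
          fibredNewtonLeibnizRel) →
        c ∈ relations := by
  intro P hP c hc
  obtain ⟨HL, hL0, hL⟩ := exists_sideRestrict (Set.Iio (-1/2 : ℝ)) wallRestrict_isSemialgebraic_Iio
  obtain ⟨HR, hR0, hR⟩ := exists_sideRestrict (Set.Ioi (-1/2 : ℝ)) wallRestrict_isSemialgebraic_Ioi
  have hA0 := stub_wallRestrict (Set.Iio (-1/2 : ℝ)) (Or.inl rfl) HL hL0 hL _ hc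
  have hD0 := stub_wallRestrict (Set.Ioi (-1/2 : ℝ)) (Or.inr rfl) HR hR0 hR _ hc
  have hA1 := stub_wallLift P hP (Set.Iio (-1/2 : ℝ)) (-2) (-1/2) (Or.inl ⟨rfl, rfl, rfl⟩) HL hL c
  have hD1 := stub_wallLift P hP (Set.Ioi (-1/2 : ℝ)) (-1/2) 2 (Or.inr ⟨rfl, rfl, rfl⟩) HR hR c
  have hA : of (piRep.slabRestrict (-2) (-1/2)) * c ∈ relations := by
    simpa using relations.add_mem hA1 hA0
  have hD : of (piRep.slabRestrict (-1/2) 2) * c ∈ relations := by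
    simpa using relations.add_mem hD1 hD0
  exact stub_archimedesOfTriangle stub_triangleConst c hA hD

/-- **Disc multiples of relations are wall-respecting relations**: `[π]·relations ⊆ fibredRelations`
(`stub_piMulFibred`) `≤` the wall closure (`stub_fibredLeWall`). [folklore] -/
theorem piMul_mem_wallClosure
    (P : ∀ n : ℕ, IntegralRep n → IntegralRep (n + 2))
    (hP : ∀ (n : ℕ) (r : IntegralRep n), (P n r).domain = {z : Fin (n + 2) → ℝ | z 0 ^ 2 + z 1 ^ 2 ≤ 1 ∧ (fun i : Fin n => z i.succ.succ) ∈ r.domain} ∧ (P n r).integrand = fun z => r.integrand (fun i : Fin n => z i.succ.succ))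
    (c : FormalRep) (hc : c ∈ relations) :
    FreeAbelianGroup.lift (fun s : (Σ n, IntegralRep n) => of (P s.1 s.2)) c ∈
          AddSubgroup.closure (domainAddRel ∪ integrandAddRel ∪
          {x | ∃ (n : ℕ) (r r' : IntegralRep (n + 1)) (Φ : (Fin (n + 1) → ℝ) → (Fin (n + 1) → ℝ))
              (Φ' : (Fin (n + 1) → ℝ) → (Fin (n + 1) → ℝ) →L[ℝ] (Fin (n + 1) → ℝ)),
            IsSemialgebraicMapOn ℚ r.domain Φ ∧
            (∀ x ∈ r.domain, HasFDerivWithinAt Φ (Φ' x) r.domain x) ∧ Set.InjOn Φ r.domain ∧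
            r'.domain = Φ '' r.domain ∧
            (∀ x ∈ r.domain, r.integrand x = r'.integrand (Φ x) * |(Φ' x).det|) ∧
            (∀ x ∈ r.domain, (Φ x 0 < -1/2 ↔ x 0 < -1/2) ∧ (-1/2 < Φ x 0 ↔ -1/2 < x 0)) ∧
            x = of r - of r'} ∪
          fibredNewtonLeibnizRel) :=
  stub_fibredLeWall (stub_piMulFibred P hP c hc)

/-- **Item 0540 ⟺ WALL REDUCTION**: `AyoubPiCancellation` holds iff every relation among disc
multiples `lift (of ∘ P) c` is a wall-respecting relation. [folklore] -/
theorem ayoubPiCancellation_iff_wallReduction :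
    Summit.KontsevichZagierPeriods.KontsevichZagierPeriods.Theses.AyoubSpecialisation.AyoubPiCancellation ↔
    ∀ (P : ∀ n : ℕ, IntegralRep n → IntegralRep (n + 2)),
      (∀ (n : ℕ) (r : IntegralRep n), (P n r).domain = {z : Fin (n + 2) → ℝ | z 0 ^ 2 + z 1 ^ 2 ≤ 1 ∧ (fun i : Fin n => z i.succ.succ) ∈ r.domain} ∧ (P n r).integrand = fun z => r.integrand (fun i : Fin n => z i.succ.succ)) →
      ∀ c : FormalRep,
        FreeAbelianGroup.lift (fun s : (Σ n, IntegralRep n) => of (P s.1 s.2)) c ∈ relations →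
        FreeAbelianGroup.lift (fun s : (Σ n, IntegralRep n) => of (P s.1 s.2)) c ∈
          AddSubgroup.closure (domainAddRel ∪ integrandAddRel ∪
          {x | ∃ (n : ℕ) (r r' : IntegralRep (n + 1)) (Φ : (Fin (n + 1) → ℝ) → (Fin (n + 1) → ℝ))
              (Φ' : (Fin (n + 1) → ℝ) → (Fin (n + 1) → ℝ) →L[ℝ] (Fin (n + 1) → ℝ)),
            IsSemialgebraicMapOn ℚ r.domain Φ ∧
            (∀ x ∈ r.domain, HasFDerivWithinAt Φ (Φ' x) r.domain x) ∧ Set.InjOn Φ r.domain ∧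
            r'.domain = Φ '' r.domain ∧
            (∀ x ∈ r.domain, r.integrand x = r'.integrand (Φ x) * |(Φ' x).det|) ∧
            (∀ x ∈ r.domain, (Φ x 0 < -1/2 ↔ x 0 < -1/2) ∧ (-1/2 < Φ x 0 ↔ -1/2 < x 0)) ∧
            x = of r - of r'} ∪
          fibredNewtonLeibnizRel) := by
  constructor
  · intro h P hP c hc
    exact piMul_mem_wallClosure P hP c (h P hP c hc)
  · intro h P hP c hc
    exact wall_ayoubPiCancellation P hP c (h P hP c hc)

/-- **`KZ.PiCancellation` ⟺ WALL REDUCTION** (through `stub_ayoubBridge`). [folklore] -/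
theorem piCancellation_iff_wallReduction :
    Literature.NumberTheory.Transcendental.KZ.PiCancellation ↔
    ∀ (P : ∀ n : ℕ, IntegralRep n → IntegralRep (n + 2)),
      (∀ (n : ℕ) (r : IntegralRep n), (P n r).domain = {z : Fin (n + 2) → ℝ | z 0 ^ 2 + z 1 ^ 2 ≤ 1 ∧ (fun i : Fin n => z i.succ.succ) ∈ r.domain} ∧ (P n r).integrand = fun z => r.integrand (fun i : Fin n => z i.succ.succ)) →
      ∀ c : FormalRep,
        FreeAbelianGroup.lift (fun s : (Σ n, IntegralRep n) => of (P s.1 s.2)) c ∈ relations →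
        FreeAbelianGroup.lift (fun s : (Σ n, IntegralRep n) => of (P s.1 s.2)) c ∈
          AddSubgroup.closure (domainAddRel ∪ integrandAddRel ∪
          {x | ∃ (n : ℕ) (r r' : IntegralRep (n + 1)) (Φ : (Fin (n + 1) → ℝ) → (Fin (n + 1) → ℝ))
              (Φ' : (Fin (n + 1) → ℝ) → (Fin (n + 1) → ℝ) →L[ℝ] (Fin (n + 1) → ℝ)),
            IsSemialgebraicMapOn ℚ r.domain Φ ∧
            (∀ x ∈ r.domain, HasFDerivWithinAt Φ (Φ' x) r.domain x) ∧ Set.InjOn Φ r.domain ∧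
            r'.domain = Φ '' r.domain ∧
            (∀ x ∈ r.domain, r.integrand x = r'.integrand (Φ x) * |(Φ' x).det|) ∧
            (∀ x ∈ r.domain, (Φ x 0 < -1/2 ↔ x 0 < -1/2) ∧ (-1/2 < Φ x 0 ↔ -1/2 < x 0)) ∧
            x = of r - of r'} ∪
          fibredNewtonLeibnizRel) :=
  stub_ayoubBridge.symm.trans ayoubPiCancellation_iff_wallReduction

/-- **THE CRUX ⟺ WALL REDUCTION**: `BetaCancellation` (stmt-13633) holds iff every relation among disc
multiples is a wall-respecting relation — the open core after seat c8 (weaker than c7's fibred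
reduction by `stub_fibredLeWall`, still ≡ item 0540). [folklore] -/
theorem betaCancellation_iff_wallReduction :
    Summit.KontsevichZagierPeriods.KontsevichZagierPeriods.Theses.TerasomaMultiplication.BetaCancellation ↔
    ∀ (P : ∀ n : ℕ, IntegralRep n → IntegralRep (n + 2)),
      (∀ (n : ℕ) (r : IntegralRep n), (P n r).domain = {z : Fin (n + 2) → ℝ | z 0 ^ 2 + z 1 ^ 2 ≤ 1 ∧ (fun i : Fin n => z i.succ.succ) ∈ r.domain} ∧ (P n r).integrand = fun z => r.integrand (fun i : Fin n => z i.succ.succ)) →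
      ∀ c : FormalRep,
        FreeAbelianGroup.lift (fun s : (Σ n, IntegralRep n) => of (P s.1 s.2)) c ∈ relations →
        FreeAbelianGroup.lift (fun s : (Σ n, IntegralRep n) => of (P s.1 s.2)) c ∈
          AddSubgroup.closure (domainAddRel ∪ integrandAddRel ∪
          {x | ∃ (n : ℕ) (r r' : IntegralRep (n + 1)) (Φ : (Fin (n + 1) → ℝ) → (Fin (n + 1) → ℝ))
              (Φ' : (Fin (n + 1) → ℝ) → (Fin (n + 1) → ℝ) →L[ℝ] (Fin (n + 1) → ℝ)),
            IsSemialgebraicMapOn ℚ r.domain Φ ∧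
            (∀ x ∈ r.domain, HasFDerivWithinAt Φ (Φ' x) r.domain x) ∧ Set.InjOn Φ r.domain ∧
            r'.domain = Φ '' r.domain ∧
            (∀ x ∈ r.domain, r.integrand x = r'.integrand (Φ x) * |(Φ' x).det|) ∧
            (∀ x ∈ r.domain, (Φ x 0 < -1/2 ↔ x 0 < -1/2) ∧ (-1/2 < Φ x 0 ↔ -1/2 < x 0)) ∧
            x = of r - of r'} ∪
          fibredNewtonLeibnizRel) :=
  betaCancellation_iff_ayoubPiCancellation.trans ayoubPiCancellation_iff_wallReduction

/-- **The crux from wall reduction** (closing term the day the open core lands). [folklore] -/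
theorem betaCancellation_of_wallReduction
    (h : ∀ (P : ∀ n : ℕ, IntegralRep n → IntegralRep (n + 2)),
      (∀ (n : ℕ) (r : IntegralRep n), (P n r).domain = {z : Fin (n + 2) → ℝ | z 0 ^ 2 + z 1 ^ 2 ≤ 1 ∧ (fun i : Fin n => z i.succ.succ) ∈ r.domain} ∧ (P n r).integrand = fun z => r.integrand (fun i : Fin n => z i.succ.succ)) →
      ∀ c : FormalRep,
        FreeAbelianGroup.lift (fun s : (Σ n, IntegralRep n) => of (P s.1 s.2)) c ∈ relations →
        FreeAbelianGroup.lift (fun s : (Σ n, IntegralRep n) => of (P s.1 s.2)) c ∈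
          AddSubgroup.closure (domainAddRel ∪ integrandAddRel ∪
          {x | ∃ (n : ℕ) (r r' : IntegralRep (n + 1)) (Φ : (Fin (n + 1) → ℝ) → (Fin (n + 1) → ℝ))
              (Φ' : (Fin (n + 1) → ℝ) → (Fin (n + 1) → ℝ) →L[ℝ] (Fin (n + 1) → ℝ)),
            IsSemialgebraicMapOn ℚ r.domain Φ ∧
            (∀ x ∈ r.domain, HasFDerivWithinAt Φ (Φ' x) r.domain x) ∧ Set.InjOn Φ r.domain ∧
            r'.domain = Φ '' r.domain ∧
            (∀ x ∈ r.domain, r.integrand x = r'.integrand (Φ x) * |(Φ' x).det|) ∧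
            (∀ x ∈ r.domain, (Φ x 0 < -1/2 ↔ x 0 < -1/2) ∧ (-1/2 < Φ x 0 ↔ -1/2 < x 0)) ∧
            x = of r - of r'} ∪
          fibredNewtonLeibnizRel)) :
    Summit.KontsevichZagierPeriods.KontsevichZagierPeriods.Theses.TerasomaMultiplication.BetaCancellation :=
  betaCancellation_iff_wallReduction.2 h

/-- **Wall reduction follows from fibred reduction** (monotonicity of the c8 reshape: the new open
stub is implied by c7's). [folklore] -/
theorem wallReduction_of_fibredReduction
    (h : ∀ (P : ∀ n : ℕ, IntegralRep n → IntegralRep (n + 2)),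
      (∀ (n : ℕ) (r : IntegralRep n), (P n r).domain = {z : Fin (n + 2) → ℝ | z 0 ^ 2 + z 1 ^ 2 ≤ 1 ∧ (fun i : Fin n => z i.succ.succ) ∈ r.domain} ∧ (P n r).integrand = fun z => r.integrand (fun i : Fin n => z i.succ.succ)) →
      ∀ c : FormalRep,
        FreeAbelianGroup.lift (fun s : (Σ n, IntegralRep n) => of (P s.1 s.2)) c ∈ relations →
        FreeAbelianGroup.lift (fun s : (Σ n, IntegralRep n) => of (P s.1 s.2)) c ∈ fibredRelations)
    (P : ∀ n : ℕ, IntegralRep n → IntegralRep (n + 2))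
    (hP : ∀ (n : ℕ) (r : IntegralRep n), (P n r).domain = {z : Fin (n + 2) → ℝ | z 0 ^ 2 + z 1 ^ 2 ≤ 1 ∧ (fun i : Fin n => z i.succ.succ) ∈ r.domain} ∧ (P n r).integrand = fun z => r.integrand (fun i : Fin n => z i.succ.succ))
    (c : FormalRep)
    (hc : FreeAbelianGroup.lift (fun s : (Σ n, IntegralRep n) => of (P s.1 s.2)) c ∈ relations) :
    FreeAbelianGroup.lift (fun s : (Σ n, IntegralRep n) => of (P s.1 s.2)) c ∈
          AddSubgroup.closure (domainAddRel ∪ integrandAddRel ∪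
          {x | ∃ (n : ℕ) (r r' : IntegralRep (n + 1)) (Φ : (Fin (n + 1) → ℝ) → (Fin (n + 1) → ℝ))
              (Φ' : (Fin (n + 1) → ℝ) → (Fin (n + 1) → ℝ) →L[ℝ] (Fin (n + 1) → ℝ)),
            IsSemialgebraicMapOn ℚ r.domain Φ ∧
            (∀ x ∈ r.domain, HasFDerivWithinAt Φ (Φ' x) r.domain x) ∧ Set.InjOn Φ r.domain ∧
            r'.domain = Φ '' r.domain ∧
            (∀ x ∈ r.domain, r.integrand x = r'.integrand (Φ x) * |(Φ' x).det|) ∧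
            (∀ x ∈ r.domain, (Φ x 0 < -1/2 ↔ x 0 < -1/2) ∧ (-1/2 < Φ x 0 ↔ -1/2 < x 0)) ∧
            x = of r - of r'} ∪
          fibredNewtonLeibnizRel) :=
  stub_fibredLeWall (h P hP c hc)

end Summit.KontsevichZagierPeriods.KontsevichZagierPeriods.BetaCancellationLine
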